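import Literature.AlgebraicGeometry.HodgeTheory.FermatAokiSubvarietyCodimension
import Literature.AlgebraicGeometry.HodgeTheory.GysinFormalism
import HarnessLib

/-!
# Aoki's Thm. 2-1 in cycle-theoretic form: claim(σ_{p,a}) from `dim V(α) ≤ 1` and `ω_σ(cl Z) ≠ 0` for a cycle supported on `Y`

Family `hodge`, layer `Literature/AlgebraicGeometry/HodgeTheory`. PROOF FILE (sequel of
`FermatAokiSubvarietyCodimension`, everything proved, no named fact) for the named fact
`Aoki1987_claim_pStandard` of `FermatInductiveClaims` — Aoki, J. Math. Soc. Japan 39 (1987),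
THEOREM 2-1 (p. 388): "The variety `Y` defined by (2.1) is a subvariety of `X^{p-1}ₘ` of
codimension `r` and it represents the class `σ_{p,a}`. More precisely we have
`ω_σ(Y)·\overline{ω_σ(Y)} = (-1)ʳ p^{p-2} mᵖ`", where "`ω_α(Z) = P_α([Z])`" is the `α`-component of
the cohomology class `[Z]` of an algebraic cycle and "if `ω_α(Z) ≠ 0`, we say that `Z` represents
the class `α`" (p. 386).

`FermatAokiSubvarietyCodimension` reduces the fact to (I) `dim V(α) ≤ 1` on `𝔄²ʳₘ` (Ran Prop. 1.7
(i)) and (II) a class SUPPORTED ON `Y` with non-zero `σ_{p,a}`-component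
(`Aoki1987_claim_pStandard_of_subvariety_represents`; `Y ⊆ X²ʳₘ` is Zariski-closed of codimension
`≥ r` pointwise, `Aoki1987.le_coheight_of_mem_fermatAokiSection`). This file states (II) in its
printed, cycle-theoretic form RELATIVE TO a `GysinFormalism` `G` — the tree's hypothesis structure
(`HodgeTheory/GysinFormalism`) for the Gysin maps and the cycle class
`cl : Z_d(X) → H^{2e}(X(ℂ); ℂ)` on smooth projective complex varieties, whose intended instance is
to be supplied by a construction (Borel–Moore fundamental classes; not in the tree): for some
`r`-cycle `Z` on `X²ʳₘ` supported on `Y` (in print `Z = Y` itself), `π_σ(cl Z) ≠ 0`. By the support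
axiom of `G` ("by construction, the class `[Z]` of a cycle `Z` of `X̄` vanishes on `X̄ – Supp Z`",
Voisin II, proof of Lemma 9.18; field `cl_restrictCompl_eq_zero`) `cl Z` is supported on `Y`, so
the previous assembly applies: `Aoki1987_claim_pStandard_of_cycleClass`.

What is NOT here: (I); the computation `ω_σ(Y)·\overline{ω_σ(Y)} = (-1)ʳ p^{p-2} mᵖ` (§§3–4:
intersection numbers `Y·Yᵍ`, Prop. 3-1 (ii)–(v), Hodge index theorem), i.e. the discharge of (II)
for the intended `G`; a construction of a `GysinFormalism`.

## References

* [Aoki1987] N. Aoki, Some new algebraic cycles on Fermat varieties, J. Math. Soc. Japan 39 (1987)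
  385–396: p. 386 (`ω_α(Z) = P_α([Z])`, "represents"), Thm. 2-1 (p. 388) (text read).
* [VoisinHodgeII2003] C. Voisin, Hodge Theory and Complex Algebraic Geometry II, CUP 2003, proof of
  Lemma 9.18 (support of the cycle class) — through `HodgeTheory/GysinFormalism`.
* [Ran1980] Z. Ran, Cycles on Fermat hypersurfaces, Compositio Math. 42 (1980), §1 Prop. 1.7 (i).
-/

noncomputable section

open CategoryTheory AlgebraicGeometry

namespace Literature.AlgebraicGeometry.HodgeTheory

open Literature.AlgebraicGeometry.Motives

/-- **`Aoki1987_claim_pStandard` from `dim V(α) ≤ 1` and "`ω_σ(Y) ≠ 0`" for the cycle class of a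
cycle supported on `Y`, relative to a Gysin formalism.** Granted a `GysinFormalism` `G` (Gysin maps
and cycle classes `cl : Z_d(X) → H^{2e}(X(ℂ); ℂ)` on smooth projective complex varieties with their
printed properties; the tree's hypothesis structure, to be supplied by a construction),
(I) `hE1`: for `r > 0` and `α ∈ 𝔄²ʳₘ` the eigenspace `V(α) ⊆ H²ʳ(X²ʳₘ(ℂ); ℂ)` is at most a line
(Ran Prop. 1.7 (i); as in `Aoki1987_claim_pStandard_of_subvariety_represents`), and
(II) `hω`: for `p = 2r + 1` prime, `p ∣ m`, `d = m/p > 2`, `(⟨a⟩, d) = 1`, some constant `c₀` and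
some `r`-dimensional cycle `Z` on `X²ʳₘ` all of whose points lie on `Y = Y_{c₀} ∩ X²ʳₘ`
(`Aoki1987.fermatAokiSection`; in print `Z = Y`, "a subvariety of `X^{p-1}ₘ` of codimension `r`",
`c₀ = εᵖ ᵈ√p`) have `π_σ(cl Z) ≠ 0` for `σ = σ_{p,a}` in Aoki's order of coordinates
(`FermatCharacter.aokiStandard`) — THEOREM 2-1: "it represents the class `σ_{p,a}`. More precisely
we have `ω_σ(Y)·\overline{ω_σ(Y)} = (-1)ʳ p^{p-2} mᵖ`" —
the named fact holds: `cl Z` is supported on the Zariski-closed `Y` (`G.cl_restrictCompl_eq_zero`),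
so `Aoki1987_claim_pStandard_of_subvariety_represents` applies. The smoothness witness `hX` and the
degree bookkeeping `hrr : r + r = 2r` of `G.cl` are bound in `hω` (proof-irrelevant).
[cite: Aoki1987, Thm. 2-1 (p. 388) and p. 386 (ω_α(Z) = P_α([Z]), "represents")]
[cite: VoisinHodgeII2003, proof of Lemma 9.18 (support of the cycle class)] -/
theorem Aoki1987_claim_pStandard_of_cycleClass (G : GysinFormalism)
    (hE1 : ∀ (m r : ℕ) [NeZero m] (α : Fin (2 * r + 2) → ZMod m), 0 < r →
      FermatCharacter.IsAdmissible α → ∃ v, fermatEigenspace m α (2 * r) ≤ ℂ ∙ v)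
    (hω : ∀ (m r : ℕ) [NeZero m] (hX : IsSmoothProjective (2 * r) (fermatHypersurface (2 * r) m))
      (hrr : r + r = 2 * r), (2 * r + 1).Prime → 2 * r + 1 ∣ m → 2 < m / (2 * r + 1) →
      ∀ a : ZMod m, Nat.Coprime a.val (m / (2 * r + 1)) →
      ∃ (c₀ : ℂ) (Z : ↥(Motives.cyclesOfDim (fermatHypersurface (2 * r) m).left r)),
        (∀ z, (Z : AlgebraicCycle (fermatHypersurface (2 * r) m).left ℤ) z ≠ 0 →
          z ∈ Aoki1987.fermatAokiSection m r (m / (2 * r + 1)) c₀) ∧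
        fermatProjector m (FermatCharacter.aokiStandard r m a) (2 * r) (G.cl hX hrr Z) ≠ 0) :
    Aoki1987_claim_pStandard := by
  refine Aoki1987_claim_pStandard_of_subvariety_represents hE1 fun m r _ hp hpm hd a ha ↦ ?_
  have hr : 0 < r := by
    rcases Nat.eq_zero_or_pos r with rfl | h
    · exact absurd hp (by decide)
    · exact h
  have hX : IsSmoothProjective (2 * r) (fermatHypersurface (2 * r) m) :=
    isSmoothProjective_fermatHypersurface (by omega) NeZero.one_le
  obtain ⟨c₀, Z, hZ, hne⟩ := hω m r hX (two_mul r).symm hp hpm hd a ha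
  exact ⟨c₀, G.cl hX (two_mul r).symm Z,
    G.cl_restrictCompl_eq_zero hX (two_mul r).symm Z (Aoki1987.isClosed_fermatAokiSection r _ c₀) hZ,
    hne⟩

end Literature.AlgebraicGeometry.HodgeTheory

end
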